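import Literature.NumberTheory.LFunctions.DirichletXiPairZeros
import Literature.NumberTheory.LFunctions.EquivalentsKeiperLiProofs
import HarnessLib

/-!
# The pair `Ξ_χ = ξ(·,χ)ξ(·,χ̄)`: the partial-fraction series of `Ξ_χ'/Ξ_χ` differentiated termwise at `s = 1`,
# and Li's computation over the Hadamard pairs

Topic `Literature/NumberTheory/LFunctions`, sub-namespace `DirichletTheta` (continuation of `DirichletXiPairHadamard.lean`,
`DirichletXiPairZeros.lean`; the `Ξ_χ`-twin of `EquivalentsKeiperLiProofs.lean` §§ "partial-fraction series … at `s = 1`").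
Everything here is PROVED; no definitions.  **RH-FREE and GRH-FREE.**

For a primitive `χ ≠ 1` and a Hadamard sequence `b` of `Ξ_χ` (`Ξ_χ(½+z)/Ξ_χ(2) = ∏ (1 − bₙ(z² − 9/4))`,
`DirichletXiPairHadamard.exists_xiPair_hadamardSeq`):

* `xiPair_one_eq_normSq`, `xiPair_one_mem_slitPlane` — `Ξ_χ(1) = |ξ(1,χ)|² > 0` (so the principal `log Ξ_χ` is
  analytic near `s = 1`);
* `logDeriv_xiPair_eq_tsum` — `Ξ_χ'/Ξ_χ(s) = Σₙ −2bₙ(s−½)/(1 − bₙ((s−½)² − 9/4))` wherever `Ξ_χ(s) ≠ 0`;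
* `hasSum_iteratedDeriv_term_one` — the series converges normally near `s = 1`, hence may be differentiated term by
  term there: `(Ξ_χ'/Ξ_χ)^{(j)}(1) = Σₙ (d/ds)ʲ[termₙ](1)`;
* `iteratedDeriv_term_one` — for `bₙ ≠ 0` the term is `1/(s−ρₙ) + 1/(s−(1−ρₙ))` near `1`, so its `j`-th derivative at `1`
  is `(−1)ʲ j! [(1−ρₙ)^{−(j+1)} + ρₙ^{−(j+1)}]`;
* **`hasSum_li_pairs`** — Li's computation (Li 1997 p. 326 / Li 2004 (2.3), for the pair):
  `(1/(n−1)!) dⁿ/dsⁿ[s^{n−1} log Ξ_χ(s)]_{s=1} = Σₙ ([1 − (1 − 1/ρₙ)ⁿ] + [1 − (1 − 1/(1−ρₙ))ⁿ])` over the Hadamard pairs.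

What is NOT here (next files): the multiplicity dictionary (`#` pairs through `ρ` = `m_χ(ρ) + m_χ̄(ρ)`) and the double
counting into `LiDirichlet.liCoeffCharRe` that yields `LiDirichletSplit`.

## References
* X.-J. Li, J. Number Theory 65 (1997), p. 326; Illinois J. Math. 48 (2004), Thm 2, (2.3). [Li1997] [Li2004]
* H. L. Montgomery, R. C. Vaughan, *Multiplicative Number Theory I*, §10.2 (10.29). [MontgomeryVaughan2007]
-/

noncomputable section

open Complex Filter Topology Set Metric
open scoped ComplexConjugate Nat

namespace Literature.NumberTheory.LFunctions

namespace DirichletTheta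

variable {q : ℕ} [NeZero q] {χ : DirichletCharacter ℂ q} {b : ℕ → ℂ}

/-! ### `Ξ_χ` at `s = 1` and `s = 0` -/

/-- `Ξ_χ(1) = ξ(1,χ)·conj ξ(1,χ) = |ξ(1,χ)|²` (`ξ(1, χ̄) = conj ξ(1, χ)`). [cite: MontgomeryVaughan2007, §10.1 p. 334] -/
theorem xiPair_one_eq_normSq (h1 : χ ≠ 1) : xiPair χ 1 = (Complex.normSq (dirichletXi χ 1) : ℂ) := by
  have h := conj_dirichletXi h1 (1 : ℂ)
  rw [map_one] at h
  rw [xiPair, ← h, Complex.mul_conj]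

/-- `Ξ_χ(1)` is a positive real number, in particular in the slit plane (primitive `χ ≠ 1`; `ξ(1,χ) ≠ 0`).
[cite: MontgomeryVaughan2007, Cor 10.8] -/
theorem xiPair_one_mem_slitPlane (hχ : χ.IsPrimitive) (h1 : χ ≠ 1) : xiPair χ 1 ∈ slitPlane := by
  rw [xiPair_one_eq_normSq h1, mem_slitPlane_iff]
  left
  rw [Complex.ofReal_re]
  exact Complex.normSq_pos.2 (dirichletXi_ne_zero_of_not_mem_strip hχ h1 (Or.inr (by norm_num)))

/-- `Ξ_χ(1) ≠ 0`. [cite: MontgomeryVaughan2007, Cor 10.8] -/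
theorem xiPair_one_ne_zero (hχ : χ.IsPrimitive) (h1 : χ ≠ 1) : xiPair χ 1 ≠ 0 :=
  slitPlane_ne_zero (xiPair_one_mem_slitPlane hχ h1)

/-- `Ξ_χ(0) ≠ 0` (`Ξ_χ(0) = Ξ_χ(1)` by the functional equation). [cite: MontgomeryVaughan2007, Cor 10.8] -/
theorem xiPair_zero_ne_zero (hχ : χ.IsPrimitive) (h1 : χ ≠ 1) : xiPair χ 0 ≠ 0 := by
  have h := xiPair_one_sub hχ (1 : ℂ)
  rw [sub_self] at h
  rw [h]
  exact xiPair_one_ne_zero hχ h1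

/-- The principal `log Ξ_χ` is analytic at `s = 1`. [folklore] -/
private theorem analyticAt_log_xiPair_one (hχ : χ.IsPrimitive) (h1 : χ ≠ 1) :
    AnalyticAt ℂ (fun s ↦ Complex.log (xiPair χ s)) 1 :=
  ((differentiable_xiPair h1).analyticAt 1).clog (xiPair_one_mem_slitPlane hχ h1)

/-- Near `s = 1`, `(log Ξ_χ)^{(j+1)}(1) = (Ξ_χ'/Ξ_χ)^{(j)}(1)` (the principal `log Ξ_χ` is a primitive of `Ξ_χ'/Ξ_χ` there).
[folklore] -/
private theorem iteratedDeriv_succ_log_xiPair_one (hχ : χ.IsPrimitive) (h1 : χ ≠ 1) (j : ℕ) :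
    iteratedDeriv (j + 1) (fun s ↦ Complex.log (xiPair χ s)) 1 = iteratedDeriv j (logDeriv (xiPair χ)) 1 := by
  rw [iteratedDeriv_succ']
  refine Filter.EventuallyEq.iteratedDeriv_eq j ?_
  have hV : ∀ᶠ s in 𝓝 (1 : ℂ), xiPair χ s ∈ slitPlane :=
    (differentiable_xiPair h1).continuous.continuousAt.eventually_mem
      (isOpen_slitPlane.mem_nhds (xiPair_one_mem_slitPlane hχ h1))
  filter_upwards [hV] with s hs
  rw [((differentiable_xiPair h1 s).hasDerivAt.clog hs).deriv, logDeriv_apply]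

/-- A closed disc `|s − 1| ≤ r` (`0 < r ≤ 1/2`) free of zeros of `Ξ_χ` (`Ξ_χ(1) ≠ 0` and continuity). [folklore] -/
private theorem exists_closedBall_one_xiPair_ne_zero (hχ : χ.IsPrimitive) (h1 : χ ≠ 1) :
    ∃ r : ℝ, 0 < r ∧ r ≤ 1 / 2 ∧ ∀ s ∈ closedBall (1 : ℂ) r, xiPair χ s ≠ 0 := by
  have hev : ∀ᶠ s in 𝓝 (1 : ℂ), xiPair χ s ≠ 0 :=
    (differentiable_xiPair h1).continuous.continuousAt.eventually_ne (xiPair_one_ne_zero hχ h1)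
  obtain ⟨ε, hε, hball⟩ := Metric.eventually_nhds_iff_ball.1 hev
  refine ⟨min (ε / 2) (1 / 2), by positivity, min_le_right _ _, fun s hs ↦ hball s ?_⟩
  exact closedBall_subset_ball (lt_of_le_of_lt (min_le_left _ _) (by linarith)) hs

/-! ### The partial-fraction series in the variable `s` -/

/-- **`Ξ_χ'/Ξ_χ(s) = Σₙ −2bₙ(s−½)/(1 − bₙ((s−½)² − 9/4))`** wherever `Ξ_χ(s) ≠ 0`, for a Hadamard sequence `b` of `Ξ_χ`.
[cite: MontgomeryVaughan2007, §10.2 (10.29)] -/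
theorem logDeriv_xiPair_eq_tsum (hbs : Summable fun n ↦ ‖b n‖) (h2 : xiPair χ 2 ≠ 0) (h1 : χ ≠ 1)
    (hprod : ∀ z : ℂ, HasProd (fun n ↦ 1 - b n * (z ^ 2 - 9 / 4)) (xiPair χ (1 / 2 + z) / xiPair χ 2))
    {s : ℂ} (hs : xiPair χ s ≠ 0) :
    logDeriv (xiPair χ) s = ∑' n, -(2 * b n * (s - 1 / 2)) / (1 - b n * ((s - 1 / 2) ^ 2 - 9 / 4)) := by
  have hs' : xiPair χ (1 / 2 + (s - 1 / 2)) ≠ 0 := by rwa [add_sub_cancel]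
  have h := logDeriv_xiPair_half_add_eq_tsum hbs h2 hprod hs'
  have hcomp : xiPair χ = (fun w ↦ xiPair χ (1 / 2 + w)) ∘ fun s ↦ s - 1 / 2 := by
    funext s; simp
  have hf : DifferentiableAt ℂ (fun w ↦ xiPair χ (1 / 2 + w)) (s - 1 / 2) :=
    ((differentiable_xiPair h1).comp ((differentiable_const _).add differentiable_id)).differentiableAt
  have hg : DifferentiableAt ℂ (fun s : ℂ ↦ s - 1 / 2) s := differentiableAt_id.sub_const _
  rw [hcomp, logDeriv_comp (f := fun w ↦ xiPair χ (1 / 2 + w)) (g := fun s : ℂ ↦ s - 1 / 2) (x := s) hf hg, h]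
  have hd : deriv (fun s : ℂ ↦ s - 1 / 2) s = 1 := by
    rw [deriv_sub_const, deriv_id'']
  rw [hd, mul_one]

/-- The terms of `Ξ_χ'/Ξ_χ` are holomorphic off the zeros of `Ξ_χ`. [folklore] -/
private theorem differentiableOn_term (h2 : xiPair χ 2 ≠ 0)
    (hprod : ∀ z : ℂ, HasProd (fun n ↦ 1 - b n * (z ^ 2 - 9 / 4)) (xiPair χ (1 / 2 + z) / xiPair χ 2)) (k : ℕ) :
    DifferentiableOn ℂ (fun s ↦ -(2 * b k * (s - 1 / 2)) / (1 - b k * ((s - 1 / 2) ^ 2 - 9 / 4)))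
      {s | xiPair χ s ≠ 0} := by
  refine DifferentiableOn.div (by fun_prop) (by fun_prop) fun s hs ↦ ?_
  exact factor_ne_zero_of_xiPair_ne_zero h2 hprod hs k

/-- **Normal convergence near `s = 1`.** On a disc `|s − 1| < r` whose closure avoids the zeros of `Ξ_χ` (`r ≤ 1/2`), the
terms are bounded by a summable sequence: `16‖bₖ‖` as soon as `‖bₖ‖ ≤ 2/13` (then `|bₖ((s−½)²−9/4)| ≤ ½`), and a compactness
bound for the finitely many other `k`. [folklore] -/
private theorem exists_summable_bound_term (hbs : Summable fun n ↦ ‖b n‖) (h2 : xiPair χ 2 ≠ 0)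
    (hprod : ∀ z : ℂ, HasProd (fun n ↦ 1 - b n * (z ^ 2 - 9 / 4)) (xiPair χ (1 / 2 + z) / xiPair χ 2))
    {r : ℝ} (hr2 : r ≤ 1 / 2) (hΞ : ∀ s ∈ closedBall (1 : ℂ) r, xiPair χ s ≠ 0) :
    ∃ u : ℕ → ℝ, Summable u ∧ ∀ k, ∀ w ∈ ball (1 : ℂ) r,
      ‖-(2 * b k * (w - 1 / 2)) / (1 - b k * ((w - 1 / 2) ^ 2 - 9 / 4))‖ ≤ u k := by
  classical
  have hbd : ∀ k, ∃ M : ℝ, ∀ w ∈ closedBall (1 : ℂ) r,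
      ‖-(2 * b k * (w - 1 / 2)) / (1 - b k * ((w - 1 / 2) ^ 2 - 9 / 4))‖ ≤ M := by
    intro k
    refine (isCompact_closedBall (1 : ℂ) r).exists_bound_of_continuousOn ?_
    exact ((differentiableOn_term h2 hprod k).mono fun w hw ↦ hΞ w hw).continuousOn
  choose M hM using hbd
  refine ⟨fun k ↦ if ‖b k‖ ≤ 2 / 13 then 16 * ‖b k‖ else M k, ?_, ?_⟩
  · refine Summable.of_norm_bounded_eventually (g := fun k ↦ 16 * ‖b k‖) (hbs.mul_left 16) ?_
    have hev : ∀ᶠ k in cofinite, ‖b k‖ ≤ 2 / 13 := by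
      have := (Summable.of_norm hbs).tendsto_cofinite_zero.norm
      rw [norm_zero] at this
      exact this.eventually (ge_mem_nhds (by norm_num : (0 : ℝ) < 2 / 13))
    filter_upwards [hev] with k hk
    simp only [hk, if_true, Real.norm_eq_abs]
    rw [abs_of_nonneg (by positivity)]
  · intro k w hw
    have hw' : w ∈ closedBall (1 : ℂ) r := ball_subset_closedBall hw
    beta_reduce
    split_ifs with hk
    · have hw1 : ‖w - 1‖ < r := by simpa [dist_eq_norm] using hw
      have hwh : ‖w - 1 / 2‖ ≤ 1 := by
        calc ‖w - 1 / 2‖ = ‖(w - 1) + 1 / 2‖ := by ring_nf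
          _ ≤ ‖w - 1‖ + ‖(1 / 2 : ℂ)‖ := norm_add_le _ _
          _ ≤ 1 := by norm_num; linarith
      have hsq : ‖(w - 1 / 2) ^ 2 - 9 / 4‖ ≤ 13 / 4 := by
        calc ‖(w - 1 / 2) ^ 2 - 9 / 4‖ ≤ ‖(w - 1 / 2) ^ 2‖ + ‖(9 / 4 : ℂ)‖ := norm_sub_le _ _
          _ = ‖w - 1 / 2‖ ^ 2 + 9 / 4 := by rw [norm_pow]; norm_num
          _ ≤ 1 + 9 / 4 := by nlinarith [norm_nonneg (w - 1 / 2)]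
          _ = 13 / 4 := by norm_num
      have hprodn : ‖b k * ((w - 1 / 2) ^ 2 - 9 / 4)‖ ≤ 1 / 2 := by
        rw [norm_mul]
        nlinarith [norm_nonneg (b k), norm_nonneg ((w - 1 / 2) ^ 2 - 9 / 4)]
      have hden : 1 / 2 ≤ ‖1 - b k * ((w - 1 / 2) ^ 2 - 9 / 4)‖ := by
        have := norm_sub_norm_le (1 : ℂ) (b k * ((w - 1 / 2) ^ 2 - 9 / 4))
        rw [norm_one] at this
        linarith
      have hnum : ‖-(2 * b k * (w - 1 / 2))‖ ≤ 2 * ‖b k‖ := by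
        rw [norm_neg, norm_mul, norm_mul, Complex.norm_two]
        nlinarith [norm_nonneg (b k), norm_nonneg (w - 1 / 2)]
      rw [norm_div, div_le_iff₀ (by linarith)]
      nlinarith [norm_nonneg (b k)]
    · exact hM k w hw'

/-- **The derivatives of `Ξ_χ'/Ξ_χ` at `s = 1`, termwise**: for a Hadamard sequence `b` of `Ξ_χ` and every `j`,
`(Ξ_χ'/Ξ_χ)^{(j)}(1) = Σₖ dʲ/dsʲ[−2bₖ(s−½)/(1 − bₖ((s−½)²−9/4))]|_{s=1}` (the series converges normally near `s = 1`).
[cite: Li1997, p. 326] -/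
theorem hasSum_iteratedDeriv_term_one (hχ : χ.IsPrimitive) (h1 : χ ≠ 1) (hbs : Summable fun n ↦ ‖b n‖)
    (hprod : ∀ z : ℂ, HasProd (fun n ↦ 1 - b n * (z ^ 2 - 9 / 4)) (xiPair χ (1 / 2 + z) / xiPair χ 2)) (j : ℕ) :
    HasSum (fun k ↦ iteratedDeriv j (fun s ↦ -(2 * b k * (s - 1 / 2)) / (1 - b k * ((s - 1 / 2) ^ 2 - 9 / 4))) 1)
      (iteratedDeriv j (logDeriv (xiPair χ)) 1) := by
  have h2 : xiPair χ 2 ≠ 0 := xiPair_two_ne_zero hχ h1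
  obtain ⟨r, hr, hr2, hΞ⟩ := exists_closedBall_one_xiPair_ne_zero hχ h1
  obtain ⟨u, hu, hle⟩ := exists_summable_bound_term hbs h2 hprod hr2 hΞ
  have hU : IsOpen (ball (1 : ℂ) r) := isOpen_ball
  have h1r : (1 : ℂ) ∈ ball (1 : ℂ) r := mem_ball_self hr
  have hdiff : ∀ k, DifferentiableOn ℂ
      (fun s ↦ -(2 * b k * (s - 1 / 2)) / (1 - b k * ((s - 1 / 2) ^ 2 - 9 / 4))) (ball (1 : ℂ) r) :=
    fun k ↦ (differentiableOn_term h2 hprod k).mono fun w hw ↦ hΞ w (ball_subset_closedBall hw)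
  have H := hasSum_iteratedDeriv_of_summable_norm hu hdiff hU hle j h1r
  have heq : EqOn (fun w ↦ ∑' k, -(2 * b k * (w - 1 / 2)) / (1 - b k * ((w - 1 / 2) ^ 2 - 9 / 4)))
      (logDeriv (xiPair χ)) (ball (1 : ℂ) r) := fun w hw ↦
    (logDeriv_xiPair_eq_tsum hbs h2 h1 hprod (hΞ w (ball_subset_closedBall hw))).symm
  rwa [heq.iteratedDeriv_of_isOpen hU j h1r] at H

/-- **The derivatives of one pair of terms at `s = 1`**: for `bₖ ≠ 0` the `k`-th term is `1/(s−ρₖ) + 1/(s−(1−ρₖ))` near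
`s = 1`, so its `j`-th derivative at `1` is `(−1)ʲ j! [(1−ρₖ)^{−(j+1)} + ρₖ^{−(j+1)}]`. [cite: Li1997, p. 326] -/
theorem iteratedDeriv_term_one (hχ : χ.IsPrimitive) (h1 : χ ≠ 1)
    (hprod : ∀ z : ℂ, HasProd (fun n ↦ 1 - b n * (z ^ 2 - 9 / 4)) (xiPair χ (1 / 2 + z) / xiPair χ 2))
    {k : ℕ} (hk : b k ≠ 0) (j : ℕ) :
    iteratedDeriv j (fun s ↦ -(2 * b k * (s - 1 / 2)) / (1 - b k * ((s - 1 / 2) ^ 2 - 9 / 4))) 1 =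
      (-1) ^ j * j ! * (((1 - xiPairZero b k)⁻¹) ^ (j + 1) + ((xiPairZero b k)⁻¹) ^ (j + 1)) := by
  have h2 : xiPair χ 2 ≠ 0 := xiPair_two_ne_zero hχ h1
  set ρ := xiPairZero b k with hρ
  have hρ0 : xiPair χ ρ = 0 := xiPair_xiPairZero h2 hprod hk
  have hρ1 : xiPair χ (1 - ρ) = 0 := xiPair_one_sub_xiPairZero h2 hprod hk
  have hΞ1 : xiPair χ 1 ≠ 0 := xiPair_one_ne_zero hχ h1
  have hev : ∀ᶠ s in 𝓝 (1 : ℂ), xiPair χ s ≠ 0 :=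
    (differentiable_xiPair h1).continuous.continuousAt.eventually_ne hΞ1
  have hfe : (fun s ↦ -(2 * b k * (s - 1 / 2)) / (1 - b k * ((s - 1 / 2) ^ 2 - 9 / 4))) =ᶠ[𝓝 1]
      fun s ↦ (1 * s - ρ)⁻¹ + (1 * s - (1 - ρ))⁻¹ := by
    filter_upwards [hev] with s hs
    rw [term_eq_inv_add_inv b hk (factor_ne_zero_of_xiPair_ne_zero h2 hprod hs k)]
    simp only [one_mul]
    rfl
  rw [hfe.iteratedDeriv_eq]
  have hne1 : (1 : ℂ) - ρ ≠ 0 := fun e ↦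
    hΞ1 (by rw [show (1 : ℂ) = 1 - ρ + ρ by ring, e, zero_add]; exact hρ0)
  have hne2 : (1 : ℂ) - (1 - ρ) ≠ 0 := by
    rw [sub_sub_cancel]
    intro e
    rw [e] at hρ0
    exact xiPair_zero_ne_zero hχ h1 hρ0
  have hc1 : ContDiffAt ℂ j (fun s : ℂ ↦ (1 * s - ρ)⁻¹) 1 := by
    refine ContDiffAt.inv (by fun_prop) (by simpa using hne1)
  have hc2 : ContDiffAt ℂ j (fun s : ℂ ↦ (1 * s - (1 - ρ))⁻¹) 1 := by
    refine ContDiffAt.inv (by fun_prop) (by simpa using hne2)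
  rw [iteratedDeriv_fun_add hc1 hc2, iteratedDeriv_eq_iterate, iteratedDeriv_eq_iterate,
    iter_deriv_inv_linear_sub j 1 ρ, iter_deriv_inv_linear_sub j 1 (1 - ρ)]
  simp only [one_pow, mul_one, sub_sub_cancel]
  have ez : ∀ a : ℂ, a ^ (-1 - j : ℤ) = (a⁻¹) ^ (j + 1) := by
    intro a
    rw [show (-1 - j : ℤ) = -((j + 1 : ℕ) : ℤ) by push_cast; ring, zpow_neg, zpow_natCast, inv_pow]
  rw [ez, ez]
  ring

/-- **Li's computation for the pair, term by term** (Li 1997 p. 326; Li 2004 (2.3) applied to `Ξ_χ = ξ(·,χ)ξ(·,χ̄)`):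
for a Hadamard sequence `b` of `Ξ_χ` and `n ≥ 1`,
`(1/(n−1)!) dⁿ/dsⁿ[s^{n−1} log Ξ_χ(s)]|_{s=1} = Σₖ ([1 − (1 − 1/ρₖ)ⁿ] + [1 − (1 − 1/(1−ρₖ))ⁿ])`, summed over the Hadamard
pairs `{ρₖ, 1 − ρₖ}` (unconditionally convergent; padding indices `bₖ = 0` contribute `0`). [cite: Li2004, Thm 2] -/
theorem hasSum_li_pairs (hχ : χ.IsPrimitive) (h1 : χ ≠ 1) (hbs : Summable fun n ↦ ‖b n‖)
    (hprod : ∀ z : ℂ, HasProd (fun n ↦ 1 - b n * (z ^ 2 - 9 / 4)) (xiPair χ (1 / 2 + z) / xiPair χ 2))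
    {n : ℕ} (hn : 1 ≤ n) :
    HasSum (fun k ↦ if b k = 0 then (0 : ℂ) else
        ((1 - (1 - 1 / xiPairZero b k) ^ n) + (1 - (1 - 1 / (1 - xiPairZero b k)) ^ n)))
      (iteratedDeriv n (fun s : ℂ ↦ s ^ (n - 1) * Complex.log (xiPair χ s)) 1 / ((n - 1)! : ℂ)) := by
  have hg : ContDiffAt ℂ n (fun s ↦ Complex.log (xiPair χ s)) 1 := (analyticAt_log_xiPair_one hχ h1).contDiffAt
  have hsum := hasSum_sum (s := Finset.range n)
    (f := fun j k ↦ (n.choose (j + 1) : ℂ) / (j ! : ℂ) *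
      iteratedDeriv j (fun s ↦ -(2 * b k * (s - 1 / 2)) / (1 - b k * ((s - 1 / 2) ^ 2 - 9 / 4))) 1)
    fun j _ ↦ (hasSum_iteratedDeriv_term_one hχ h1 hbs hprod j).mul_left ((n.choose (j + 1) : ℂ) / (j ! : ℂ))
  convert hsum using 1
  · funext k
    split_ifs with hk
    · simp [hk]
    · simp only [iteratedDeriv_term_one hχ h1 hprod hk]
      have hj : ∀ j ∈ Finset.range n, (n.choose (j + 1) : ℂ) / (j ! : ℂ) *
          ((-1) ^ j * j ! * (((1 - xiPairZero b k)⁻¹) ^ (j + 1) + ((xiPairZero b k)⁻¹) ^ (j + 1))) =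
          (n.choose (j + 1) : ℂ) * ((-1) ^ j * ((1 - xiPairZero b k)⁻¹) ^ (j + 1)) +
          (n.choose (j + 1) : ℂ) * ((-1) ^ j * ((xiPairZero b k)⁻¹) ^ (j + 1)) := by
        intro j _
        have hj0 : (j ! : ℂ) ≠ 0 := by exact_mod_cast (Nat.factorial_pos j).ne'
        field_simp
      rw [Finset.sum_congr rfl hj, Finset.sum_add_distrib, sum_range_choose_succ_mul_neg_pow,
        sum_range_choose_succ_mul_neg_pow]
      simp only [one_div]
      ring
  · rw [iteratedDeriv_pow_mul_one_eq_sum hn hg, Finset.sum_div]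
    refine Finset.sum_congr rfl fun j _ ↦ ?_
    rw [iteratedDeriv_succ_log_xiPair_one hχ h1]
    have h0 : ((n - 1)! : ℂ) ≠ 0 := by exact_mod_cast (Nat.factorial_pos _).ne'
    have hj0 : (j ! : ℂ) ≠ 0 := by exact_mod_cast (Nat.factorial_pos j).ne'
    field_simp

end DirichletTheta

end Literature.NumberTheory.LFunctions

end
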